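import Summits.Ventures.HodgeRepro2.T7SupportTwoVectorArchimedean
import Summits.Ventures.HodgeRepro2.Tier7.Line3.DensityTransfer
import Summits.Ventures.HodgeRepro2.Tier7.Line3.ArchFiniteCompat

/-!
# From Lemma WA′'s conclusion to the regular `γ₀`: the bridge (support, seat p1)

Lemma WA′ (Tier7/Line3/DensityTransfer `dense_of_approximations`, seat t7-L1-p3) concludes `Dense (Γ : Set (∀ v, G v))`
for the diagonal `Γ = U(W_A)(F)` inside the product over a FINITE set `T` of places (archimedean and finite). The
archimedean half of `(b′)` (L3-ARGUMENT §2g′ (2)) needs a `γ₀ ∈ Γ` that is REGULAR at every archimedean place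
`v ∈ T_∞ ⊆ T` with `∏_{v ∈ T_∞} ⟪u_A, π⁰_v(γ₀ h_v) u_A⟫ ≠ 0`. This file is that composition, in the kernel:

* the restriction of `Γ` to the coordinates in `T_∞` is dense (L1-p3's `dense_restrict_image`, not restated);
* `T7SupportTwoVectorArchimedean.exists_mem_dense_forall_regular_twoVectorOrbital_ne_zero` on the Pi type over `T_∞`;
* hence `exists_mem_dense_forall_regular_twoVectorOrbital_ne_zero_of_dense`: `∃ γ₀ ∈ Γ, ∀ v ∈ T_∞, γ₀ v ∉ Z v ∧
  twoVectorOrbital_v (γ₀ v) ≠ 0`, and `exists_mem_dense_regular_prod_coeff_ne_zero_of_dense`: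
  `∃ γ₀ ∈ Γ, (∀ v ∈ T_∞, γ₀ v ∉ Z v) ∧ ∏_{v ∈ T_∞} ⟪x_v, τ_v(γ₀ v · h_v) x_v⟫ ≠ 0`.

* ALL PLACES AT ONCE (`exists_mem_dense_regular_twoVectorOrbital_ne_zero_and_mem`, `exists_mem_of_approximations_regular_twoVectorOrbital_ne_zero`):
  with the two-vector data given at the places of `T_∞` only and ANY non-empty open conditions `U v` at the other places
  of `T` (the support of `f_fin`, the κ-congruence class — L1-p3's ArchFiniteCompat (C3)), a dense `Γ` — or, through
  ArchFiniteCompat (C4) `exists_mem_of_approximations`, the four displayed inputs of Lemma WA′ — yields `γ₀ ∈ Γ` regular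
  with non-zero two-vector orbital integral at every `v ∈ T_∞` AND `γ₀ v ∈ U v` at every `v ∉ T_∞`: L1-p3's (C1)
  `exists_mem_dense_pi_open` on the box whose `T_∞`-sides are the open non-empty loci `regularNonvanishing` of row 715.

In the first two theorems the places outside `T_∞` are untouched (`γ₀` is constrained only at `T_∞`); the last two carry
the finite-place conditions as well (L1-p3's (C1)/(C4) consumed by name, nothing restated). What stays in words: that `Γ` IS dense (Lemma WA′'s
four printed inputs on the real `U(W_A)`) and the dictionary real place ↔ `(G v, τ v, x v, h v, Z v)`.

Nothing about the adelic group beyond a dense subset of a finite product, nothing about any period or (N).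
Blind lane: Mathlib + the HodgeRepro2 prefix only; no sorry; axioms ⊆ {propext, Classical.choice, Quot.sound}.
-/

namespace Summit.Ventures.HodgeRepro2.T7SupportTwoVectorArchimedeanBridge

open scoped InnerProductSpace
open T7SupportWeightTorusOrbital T7SupportWeightTorusContinuous T7SupportTwoVectorArchimedean

variable [MeasurableSpace Circle] [BorelSpace Circle]

variable {ι : Type*} {G : ι → Type*} [∀ v, Group (G v)] [∀ v, TopologicalSpace (G v)] [∀ v, ContinuousMul (G v)]
  {V : ι → Type*} [∀ v, NormedAddCommGroup (V v)] [∀ v, InnerProductSpace ℂ (V v)]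

/-- **a dense `Γ ⊆ ∏_{v ∈ T} G_v` contains a `γ₀` regular at every place of `T_∞ ⊆ T` with every two-vector orbital
integral there non-zero** — Lemma WA′'s conclusion composed with the Pi-form theorem on the coordinates `T_∞` -/
theorem exists_mem_dense_forall_regular_twoVectorOrbital_ne_zero_of_dense (Tarch : Set ι) [Fintype Tarch]
    {τ : ∀ v, G v →* (V v →ₗ[ℂ] V v)} (hτ : ∀ v, IsUnitaryRep (τ v)) (hc : ∀ v, IsStronglyContinuous (τ v))
    {ρA ρB : ∀ v, Circle →* G v} {a b : ι → ℤ} {x : ∀ v, V v} (hA : ∀ v, IsWeightVector (τ v) (ρA v) (a v) (x v))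
    (hB : ∀ v, IsWeightVector (τ v) (ρB v) (b v) (x v)) (hx : ∀ v, x v ≠ 0) (h : ∀ v, G v) {Z : ∀ v, Set (G v)}
    (hZc : ∀ v, IsClosed (Z v)) (hZ : ∀ v, interior (Z v) = ∅) {Γ : Set (∀ v, G v)} (hΓ : Dense Γ) :
    ∃ γ₀ ∈ Γ, ∀ v ∈ Tarch, γ₀ v ∉ Z v ∧ twoVectorOrbital (τ v) (ρA v) (ρB v) (x v) (h v) (a v) (b v) (γ₀ v) ≠ 0 := by
  have hS : Dense (Tarch.restrict '' Γ) := Tier7.Line3.DensityTransfer.dense_restrict_image Tarch hΓ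
  obtain ⟨γ', hγ', hreg⟩ := exists_mem_dense_forall_regular_twoVectorOrbital_ne_zero
    (τ := fun v : Tarch => τ v) (fun v => hτ v) (fun v => hc v) (ρA := fun v : Tarch => ρA v) (ρB := fun v : Tarch => ρB v)
    (a := fun v : Tarch => a v) (b := fun v : Tarch => b v) (x := fun v : Tarch => x v) (fun v => hA v) (fun v => hB v)
    (fun v => hx v) (fun v : Tarch => h v) (Z := fun v : Tarch => Z v) (fun v => hZc v) (fun v => hZ v) hS
  obtain ⟨γ₀, hγ₀Γ, rfl⟩ := hγ'
  exact ⟨γ₀, hγ₀Γ, fun v hv => hreg ⟨v, hv⟩⟩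

/-- the same with the conclusion as the PRODUCT over `T_∞` of the diagonal coefficients:
`∏_{v ∈ T_∞} ⟪x_v, τ_v(γ₀ v · h_v) x_v⟫ ≠ 0` at a `γ₀ ∈ Γ` regular at every `v ∈ T_∞` -/
theorem exists_mem_dense_regular_prod_coeff_ne_zero_of_dense (Tarch : Set ι) [Fintype Tarch]
    {τ : ∀ v, G v →* (V v →ₗ[ℂ] V v)} (hτ : ∀ v, IsUnitaryRep (τ v)) (hc : ∀ v, IsStronglyContinuous (τ v))
    {ρA ρB : ∀ v, Circle →* G v} {a b : ι → ℤ} {x : ∀ v, V v} (hA : ∀ v, IsWeightVector (τ v) (ρA v) (a v) (x v))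
    (hB : ∀ v, IsWeightVector (τ v) (ρB v) (b v) (x v)) (hx : ∀ v, x v ≠ 0) (h : ∀ v, G v) {Z : ∀ v, Set (G v)}
    (hZc : ∀ v, IsClosed (Z v)) (hZ : ∀ v, interior (Z v) = ∅) {Γ : Set (∀ v, G v)} (hΓ : Dense Γ) :
    ∃ γ₀ ∈ Γ, (∀ v ∈ Tarch, γ₀ v ∉ Z v) ∧ ∏ v : Tarch, coeff (τ v) (x v) (x v) (γ₀ v * h v) ≠ 0 := by
  obtain ⟨γ₀, hγ₀Γ, hreg⟩ := exists_mem_dense_forall_regular_twoVectorOrbital_ne_zero_of_dense Tarch hτ hc hA hB hx h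
    hZc hZ hΓ
  refine ⟨γ₀, hγ₀Γ, fun v hv => (hreg v hv).1, Finset.prod_ne_zero_iff.2 fun v _ => ?_⟩
  rw [← twoVectorOrbital_eq (hτ v) (hA v) (hB v) (h v) (γ₀ v)]
  exact (hreg v v.2).2

/-- the Subgroup form: `Γ ≤ ∏_v G_v` dense (the literal conclusion of `DensityTransfer.dense_of_approximations`) -/
theorem exists_mem_subgroup_regular_prod_coeff_ne_zero_of_dense (Tarch : Set ι) [Fintype Tarch]
    {τ : ∀ v, G v →* (V v →ₗ[ℂ] V v)} (hτ : ∀ v, IsUnitaryRep (τ v)) (hc : ∀ v, IsStronglyContinuous (τ v))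
    {ρA ρB : ∀ v, Circle →* G v} {a b : ι → ℤ} {x : ∀ v, V v} (hA : ∀ v, IsWeightVector (τ v) (ρA v) (a v) (x v))
    (hB : ∀ v, IsWeightVector (τ v) (ρB v) (b v) (x v)) (hx : ∀ v, x v ≠ 0) (h : ∀ v, G v) {Z : ∀ v, Set (G v)}
    (hZc : ∀ v, IsClosed (Z v)) (hZ : ∀ v, interior (Z v) = ∅) (Γ : Subgroup (∀ v, G v))
    (hΓ : Dense (Γ : Set (∀ v, G v))) :
    ∃ γ₀ ∈ Γ, (∀ v ∈ Tarch, γ₀ v ∉ Z v) ∧ ∏ v : Tarch, coeff (τ v) (x v) (x v) (γ₀ v * h v) ≠ 0 :=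
  exists_mem_dense_regular_prod_coeff_ne_zero_of_dense Tarch hτ hc hA hB hx h hZc hZ hΓ


/-! ### All places at once: the two-vector loci at `T_∞`, arbitrary open non-empty conditions elsewhere -/

section AllPlaces

variable {ι : Type*} [Finite ι] {G : ι → Type*} [∀ v, Group (G v)] [∀ v, TopologicalSpace (G v)]
  [∀ v, ContinuousMul (G v)] (Tarch : Set ι) {V : Tarch → Type*} [∀ v, NormedAddCommGroup (V v)]
  [∀ v, InnerProductSpace ℂ (V v)]

/-- **a dense `Γ ⊆ ∏_{v ∈ T} G_v` contains a `γ₀` regular with non-zero two-vector orbital integral at every `v ∈ T_∞`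
and inside any prescribed non-empty open `U v` at every `v ∉ T_∞`** — the box whose sides are row 715's loci at `T_∞`
and the `U v` elsewhere is open and non-empty; L1-p3's (C1) `exists_mem_dense_pi_open` meets it -/
theorem exists_mem_dense_regular_twoVectorOrbital_ne_zero_and_mem {τ : ∀ v : Tarch, G v →* (V v →ₗ[ℂ] V v)}
    (hτ : ∀ v, IsUnitaryRep (τ v)) (hc : ∀ v, IsStronglyContinuous (τ v)) {ρA ρB : ∀ v : Tarch, Circle →* G v}
    {a b : Tarch → ℤ} {x : ∀ v, V v} (hA : ∀ v, IsWeightVector (τ v) (ρA v) (a v) (x v))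
    (hB : ∀ v, IsWeightVector (τ v) (ρB v) (b v) (x v)) (hx : ∀ v, x v ≠ 0) (h : ∀ v : Tarch, G v)
    {Z : ∀ v : Tarch, Set (G v)} (hZc : ∀ v, IsClosed (Z v)) (hZ : ∀ v, interior (Z v) = ∅)
    {U : ∀ v, Set (G v)} (hU : ∀ v, v ∉ Tarch → IsOpen (U v)) (hUne : ∀ v, v ∉ Tarch → (U v).Nonempty)
    {Γ : Set (∀ v, G v)} (hΓ : Dense Γ) :
    ∃ γ₀ ∈ Γ, (∀ (v : ι) (hv : v ∈ Tarch), γ₀ v ∉ Z ⟨v, hv⟩ ∧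
        twoVectorOrbital (τ ⟨v, hv⟩) (ρA ⟨v, hv⟩) (ρB ⟨v, hv⟩) (x ⟨v, hv⟩) (h ⟨v, hv⟩) (a ⟨v, hv⟩) (b ⟨v, hv⟩) (γ₀ v)
          ≠ 0) ∧
      ∀ v, v ∉ Tarch → γ₀ v ∈ U v := by
  classical
  -- the box: row 715's locus at the places of `T_∞`, the prescribed `U v` elsewhere
  let W : ∀ v, Set (G v) := fun v =>
    if hv : v ∈ Tarch then
      regularNonvanishing (τ ⟨v, hv⟩) (ρA ⟨v, hv⟩) (ρB ⟨v, hv⟩) (x ⟨v, hv⟩) (h ⟨v, hv⟩) (a ⟨v, hv⟩) (b ⟨v, hv⟩)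
        (Z ⟨v, hv⟩)
    else U v
  have hWo : ∀ v, IsOpen (W v) := by
    intro v
    by_cases hv : v ∈ Tarch
    · simp only [W, dif_pos hv]
      exact isOpen_regularNonvanishing (hτ ⟨v, hv⟩) (hc ⟨v, hv⟩) (hA ⟨v, hv⟩) (hB ⟨v, hv⟩) (h ⟨v, hv⟩) (hZc ⟨v, hv⟩)
    · simp only [W, dif_neg hv]
      exact hU v hv
  have hWne : ∀ v, (W v).Nonempty := by
    intro v
    by_cases hv : v ∈ Tarch
    · simp only [W, dif_pos hv]
      exact nonempty_regularNonvanishing (hτ ⟨v, hv⟩) (hc ⟨v, hv⟩) (hA ⟨v, hv⟩) (hB ⟨v, hv⟩) (hx ⟨v, hv⟩) (h ⟨v, hv⟩)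
        (hZ ⟨v, hv⟩)
    · simp only [W, dif_neg hv]
      exact hUne v hv
  obtain ⟨γ₀, hγ₀Γ, hγ₀⟩ := Tier7.Line3.ArchFiniteCompat.exists_mem_dense_pi_open hΓ hWo hWne
  refine ⟨γ₀, hγ₀Γ, fun v hv => ?_, fun v hv => ?_⟩
  · have := hγ₀ v
    simp only [W, dif_pos hv] at this
    exact this
  · have := hγ₀ v
    simp only [W, dif_neg hv] at this
    exact this

variable {N E : ι → Type*} [∀ v, IsTopologicalGroup (G v)] [∀ v, Group (N v)] [∀ v, TopologicalSpace (N v)]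
  [∀ v, TopologicalSpace (E v)]

omit [∀ v, ContinuousMul (G v)] in
/-- **THE COMPOSITE WITH LEMMA WA′'s DISPLAYED INPUTS** (L1-p3's ArchFiniteCompat (C4) `exists_mem_of_approximations`
on the same box): under (SA) strong approximation at `T` for `ker det`, (WA) the field dense at `T`, (H90) the local
Hilbert-90 surjections matched by elements of `Γ`, and the continuous det sections, there is `γ₀ ∈ Γ` regular with
non-zero two-vector orbital integral at every `v ∈ T_∞` and inside the prescribed open conditions at every `v ∉ T_∞` -/
theorem exists_mem_of_approximations_regular_twoVectorOrbital_ne_zero (det : ∀ v, G v →* N v) (q : ∀ v, E v → N v)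
    (hq : ∀ v, Continuous (q v)) (hqs : ∀ v, Function.Surjective (q v)) (s : ∀ v, N v → G v)
    (hs : ∀ v, Continuous (s v)) (hdet_s : ∀ v n, det v (s v n) = n) (Γ : Subgroup (∀ v, G v))
    (hSA : ∀ x : ∀ v, G v, (∀ v, det v (x v) = 1) → x ∈ closure (Γ : Set (∀ v, G v)))
    {S : Set (∀ v, E v)} (hWA : Dense S)
    (hH90 : ∀ z ∈ S, ∃ γ ∈ Γ, ∀ v, det v (γ v) = q v (z v))
    {τ : ∀ v : Tarch, G v →* (V v →ₗ[ℂ] V v)}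
    (hτ : ∀ v, IsUnitaryRep (τ v)) (hc : ∀ v, IsStronglyContinuous (τ v)) {ρA ρB : ∀ v : Tarch, Circle →* G v}
    {a b : Tarch → ℤ} {x : ∀ v, V v} (hA : ∀ v, IsWeightVector (τ v) (ρA v) (a v) (x v))
    (hB : ∀ v, IsWeightVector (τ v) (ρB v) (b v) (x v)) (hx : ∀ v, x v ≠ 0) (h : ∀ v : Tarch, G v)
    {Z : ∀ v : Tarch, Set (G v)} (hZc : ∀ v, IsClosed (Z v)) (hZ : ∀ v, interior (Z v) = ∅)
    {U : ∀ v, Set (G v)} (hU : ∀ v, v ∉ Tarch → IsOpen (U v)) (hUne : ∀ v, v ∉ Tarch → (U v).Nonempty) :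
    ∃ γ₀ ∈ Γ, (∀ (v : ι) (hv : v ∈ Tarch), γ₀ v ∉ Z ⟨v, hv⟩ ∧
        twoVectorOrbital (τ ⟨v, hv⟩) (ρA ⟨v, hv⟩) (ρB ⟨v, hv⟩) (x ⟨v, hv⟩) (h ⟨v, hv⟩) (a ⟨v, hv⟩) (b ⟨v, hv⟩) (γ₀ v)
          ≠ 0) ∧
      ∀ v, v ∉ Tarch → γ₀ v ∈ U v :=
  exists_mem_dense_regular_twoVectorOrbital_ne_zero_and_mem Tarch hτ hc hA hB hx h hZc hZ hU hUne
    (Tier7.Line3.DensityTransfer.dense_of_approximations det q hq hqs s hs hdet_s Γ hSA hWA hH90)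

end AllPlaces

end Summit.Ventures.HodgeRepro2.T7SupportTwoVectorArchimedeanBridge
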